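import Summits.QuantumFields.YangMills.Theorems.BalabanUVNodesN08Thm2AtRecordWindowNecessity
import Summits.QuantumFields.YangMills.Theorems.BalabanUVNodesN08Thm2AtRecordSeamK0
import Summits.QuantumFields.YangMills.Theorems.BalabanUVNodesK0VariationalThm1DatumCoupling
import Literature.MathematicalPhysics.QuantumLattice.GaugeGroupsProofs

/-!
# BalabanUVNodes ∕ N08 — [Balaban1985UV3] Thm 2 at the runs of record: THE LEVEL-0 WINDOW OF (47) AT THE RECORD'S BINDERS IS EXACTLY A CONDITION ON
# THE ∃-CONSTANTS — `(47)₀ ⟺ ε₁(0) ≤ εbg ∨ 2 < εbg` on `SU(N)`, `N ≥ 2`, and the record's Thm-2 conjunct forces it at every member of the family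

Track A, DAG node N08 = T. Bałaban, CMP **102** (1985) 255–275 [Balaban1985UV3], (47) p. 267, (4) p. 256 «|U(∂p) − 1| < ε₁», (7) p. 257 «ε₁ = g₀p(g₀)», (1) p. 256,
Thm 2 p. 272; [7] = [Balaban1985Variational] (2) p. 278 «|U(∂p) − 1| < ε» (the class of the level-0 minimiser); [Balaban1985Averaging] (9) p. 19 (plaquette
variables), (19) p. 21 (`|· − 1|` = operator norm).  Cell `pub-ymgap`, width seat `pub-ymgap-dag-n08-w1` (g2), W-SEAT-START-LIST §n08 item 1 successor piece (o1) =
file 8; `--supports` K1⁷ `StabilityBAtRecordR13SepCoPH` (helper).  Companion of `…N08Thm2AtRecordLevelZero` §2 (`ineq47_zero_iff_window`: (47)₀ at the record's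
binders ⟺ every NON-FLAT configuration of the (4)-window lies in [7]'s level-0 class), `…WindowNecessity` (the one-bond configuration; necessity up to a factor 4
and the group's distance spectrum) and `…SeamK0` §1 (`|g − 1| ≤ 2` on `SU(N)`; a class of radius `> 2` is everything).

WHAT THIS FILE PROVES (kernel; theorems only, 0 def; nothing of the paper asserted).
* §1 THE ONE-BOND CONFIGURATION, SHARP.  On a torus with `≥ 2` sites per direction the four bonds of a plaquette are pairwise distinct, so a plaquette meets the
  bond `b₀` at most once: for `V = (b = b₀ ? g : 1)` every plaquette variable is `1`, `g` or `g⁻¹` (`plaqHol_oneBond_cases`), hence **`|V(∂p) − 1| ≤ |g − 1|`**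
  (`dist1_plaqHol_oneBond_le_dist1`; `WindowNecessity` had the factor `4`).
* §2 `SU(N)` BOOKKEEPING: `g ≠ 1 ⇒ Re tr g < 1` (`reTr_lt_one_of_ne_one`, from the tree's `QuantumLattice.eq_one_of_reTr_eq`); `|g − 1| > 0 ⇒ g ≠ 1`; `SU(1) = {1}`.
  The distance spectrum `{|g − 1| : g ∈ SU(N)} = [0, 2]` for `N ≥ 2` is the tree's `K0VariationalThm1DatumCoupling.exists_su_dist1_eq` (n21-c), CITED BY NAME.
* §3 ★★ **THE EXACT WINDOW** (`window_iff_consts`): for `N ≥ 2` and `εbg > 0`, «every non-flat `V` with `|V(∂p) − 1| < ε₁(0)` for all `p` has `|V(∂p) − 1| < εbg·η₀²`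
  for all `p`» ⟺ **`ε₁(0) ≤ εbg ∨ 2 < εbg`** (⟸: inclusion of the windows, resp. `SeamK0`'s dissolution; ⟹: at `εbg < ε₁(0)`, `εbg ≤ 2` the one-bond configuration
  at a `g` with `|g − 1| = εbg` is in the (4)-window, is not flat, and is NOT in the class — the inequality of [7] (2) is strict).  Hence ★★ `ineq47_zero_iff_consts`:
  **(47) AT LEVEL 0 HOLDS AT THE RECORD'S BINDERS `runObjects₀A N 𝔞 𝔗 (Backgrounds.ofAvg N L 𝔞) c S` (tower objects with (43)@0) IFF `eps1OfPrint c S 0 ≤ c.εbg ∨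
  2 < c.εbg`** — a decidable condition on the ∃-constants and the coupling `g₀(S)` alone; with the k = 0 history-functional bound also `step0_iff_consts`.  For `N = 1`
  every configuration is the unit and (47)₀ holds unconditionally (`ineq47_zero_of_N_eq_one`).  Slot-of-record instances (`𝔞 := avOfPrint`, `Backgrounds.ofPrint`).
* §4 ★★ **THE RECORD'S Thm-2 CONJUNCT FORCES THE CONDITION**: the ∃-representation reading `Repr41_47G … c S 0` at the record's binders carries a leaf system, whose
  `noInt0` is (43)@0 and whose (47)₀ is the above; so `B10.Thm2Printed (runsAtG N (runObjects₀A …) c)` gives «`ε₁(0)(S) ≤ εbg ∨ 2 < εbg`» AT EVERY MEMBER `S` of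
  `Family L c.eps0` (`consts_of_thm2Printed_runsAtG`; contrapositive `not_thm2Printed_runsAtG_of_member`: `0 < εbg ≤ 2` and ONE member with `εbg < ε₁(0)(S)` kill
  the conjunct, whatever the `k ≥ 1` leaves), and every witness `c` of `PrintedUV3G` at the slot of record's binders satisfies it (`consts_of_printedUV3G_ofPrint`,
  `consts_of_printedUV3V`; likewise the primed slot, `consts_of_printedUV3V'` — the condition does not see the averaging).
  This is the located reading (R1) of the g0 summary (bus l.25522) as a NECESSARY CONDITION on the ∃-constants: a supplier of the slot of record either takes
  `εbg > 2` (level-0 class = everything) or keeps print's (4)-window `g₀p(g₀)` below [7]'s radius at every lattice approximation it serves (cf. `…WindowCeiling`).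

HONEST FRAMING: count-neutral helper; N08 NOT discharged; nothing of [B10] asserted; `PrintedUV3V` ∕ [B10] Thm 2 at the record NOT proved (the `k ≥ 1` cluster-expansion
leaves at the record's binders remain the object gap); one finite 𝕋⁴ programme at fixed ε, Bałaban AS PRINTED — R4 closes the conditional finite-𝕋⁴ rung `BalabanLadder.UV`
only; the Yang–Mills mass gap (Clay) is NOT proved by any of this; nothing continuum ∕ ℝ⁴ ∕ OS.  No `sorry`, standard axioms.
-/

noncomputable section

namespace Summit.QuantumFields.YangMills.BalabanUVNodes.N08Thm2AtRecordWindowExact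

open Literature.MathematicalPhysics.QuantumFieldTheory.Balaban1983to89
open Literature.MathematicalPhysics.QuantumFieldTheory.Balaban1983to89.Node00 (SU TFamily₃)
open Literature.MathematicalPhysics.QuantumFieldTheory.Balaban1983to89.B10RunsOfRecord
open Literature.MathematicalPhysics.QuantumFieldTheory.Balaban1985CMP102
open Literature.MathematicalPhysics.QuantumFieldTheory.Balaban1985CMP102.Setting
open Literature.MathematicalPhysics.QuantumFieldTheory.Balaban1985CMP102.Theorems (Family)
open Literature.MathematicalPhysics.QuantumLattice (fundamentalRep)
open Summit.QuantumFields.YangMills.BalabanUVNodes.N08Thm2AtRecordLevelZero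
open Summit.QuantumFields.YangMills.BalabanUVNodes.N08Thm2AtRecordSeamK0
open Summit.QuantumFields.YangMills.BalabanUVNodes.N08Thm2AtRecordWindowNecessity

/-! ## §1 The one-bond configuration, sharp: a plaquette meets a bond at most once -/
section OneBondSharp

variable {P : Params} {j : ℕ} {G : Type*} [GaugeGroup G]

/-- **Every plaquette variable of the one-bond configuration is `1`, `g` or `g⁻¹`**: the four bonds `⟨x, μ⟩, ⟨x + e_μ, ν⟩, ⟨x + e_ν, μ⟩, ⟨x, ν⟩` of a plaquette
(`μ < ν`) are pairwise distinct (two differ by direction, the others by `x + e ≠ x` on a torus with `≥ 2` sites per direction), so at most one of them is `b₀`.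
[cite: Balaban1985Averaging, (9) p.19 (plaquette variables; bookkeeping)] -/
theorem plaqHol_oneBond_cases {V : GaugeField P j G} {b₀ : PBond P j} {g : G} (hV : ∀ b, b ≠ b₀ → V b = 1) (hV₀ : V b₀ = g)
    (p : Plaq P j) : GaugeField.plaqHol V p = 1 ∨ GaugeField.plaqHol V p = g ∨ GaugeField.plaqHol V p = g⁻¹ := by
  have hμν : p.μ ≠ p.ν := ne_of_lt p.hμν
  have h1 := P.one_lt_sitesPerDir j
  unfold GaugeField.plaqHol
  by_cases hb1 : (⟨p.src, p.μ⟩ : PBond P j) = b₀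
  · -- the first bond is `b₀`; the other three are not
    have hb2 : (⟨p.src.shift p.μ, p.ν⟩ : PBond P j) ≠ b₀ := fun h => hμν (congrArg PBond.dir (hb1.trans h.symm))
    have hb3 : (⟨p.src.shift p.ν, p.μ⟩ : PBond P j) ≠ b₀ := fun h =>
      shift_ne_self h1 p.src p.ν (congrArg PBond.src (h.trans hb1.symm))
    have hb4 : (⟨p.src, p.ν⟩ : PBond P j) ≠ b₀ := fun h => hμν (congrArg PBond.dir (hb1.trans h.symm))
    rw [hb1, hV₀, hV _ hb2, hV _ hb3, hV _ hb4, inv_one, mul_one, mul_one, mul_one]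
    exact Or.inr (Or.inl rfl)
  by_cases hb2 : (⟨p.src.shift p.μ, p.ν⟩ : PBond P j) = b₀
  · have hb3 : (⟨p.src.shift p.ν, p.μ⟩ : PBond P j) ≠ b₀ := fun h => hμν (congrArg PBond.dir (h.trans hb2.symm))
    have hb4 : (⟨p.src, p.ν⟩ : PBond P j) ≠ b₀ := fun h =>
      shift_ne_self h1 p.src p.μ (congrArg PBond.src (hb2.trans h.symm))
    rw [hb2, hV₀, hV _ hb1, hV _ hb3, hV _ hb4, inv_one, one_mul, mul_one, mul_one]
    exact Or.inr (Or.inl rfl)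
  by_cases hb3 : (⟨p.src.shift p.ν, p.μ⟩ : PBond P j) = b₀
  · have hb4 : (⟨p.src, p.ν⟩ : PBond P j) ≠ b₀ := fun h => hμν (congrArg PBond.dir (h.trans hb3.symm)).symm
    rw [hb3, hV₀, hV _ hb1, hV _ hb2, hV _ hb4, inv_one, one_mul, one_mul, mul_one]
    exact Or.inr (Or.inr rfl)
  by_cases hb4 : (⟨p.src, p.ν⟩ : PBond P j) = b₀
  · rw [hb4, hV₀, hV _ hb1, hV _ hb2, hV _ hb3, inv_one, one_mul, one_mul, one_mul]
    exact Or.inr (Or.inr rfl)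
  · rw [hV _ hb1, hV _ hb2, hV _ hb3, hV _ hb4, inv_one, one_mul, one_mul, mul_one]
    exact Or.inl rfl

/-- ★ **`|V(∂p) − 1| ≤ |g − 1|` for every plaquette of the one-bond configuration** (factor `1`; `|1 − 1| = 0`, `|g⁻¹ − 1| = |g − 1|`).
[cite: Balaban1985Averaging, (9) p.19 + (19) p.21 (bookkeeping)] -/
theorem dist1_plaqHol_oneBond_le_dist1 {V : GaugeField P j G} {b₀ : PBond P j} {g : G} (hV : ∀ b, b ≠ b₀ → V b = 1) (hV₀ : V b₀ = g)
    (p : Plaq P j) : dist1 (GaugeField.plaqHol V p) ≤ dist1 g := by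
  rcases plaqHol_oneBond_cases hV hV₀ p with h | h | h
  · rw [h, GaugeGroup.dist1_one]; exact GaugeGroup.dist1_nonneg g
  · rw [h]
  · rw [h, GaugeGroup.dist1_inv]

/-- The one-bond configuration lies in every window of radius `> |g − 1|`. [cite: Balaban1985UV3, (4) p.256 (bookkeeping)] -/
theorem plaqSmall_oneBond {V : GaugeField P j G} {b₀ : PBond P j} {g : G} (hV : ∀ b, b ≠ b₀ → V b = 1) (hV₀ : V b₀ = g) {δ : ℝ}
    (hδ : dist1 g < δ) : PlaqSmall δ V :=
  fun p => lt_of_le_of_lt (dist1_plaqHol_oneBond_le_dist1 hV hV₀ p) hδ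

end OneBondSharp

/-! ## §2 `SU(N)` bookkeeping: `g ≠ 1 ⇒ Re tr g < 1`; `|g − 1| > 0 ⇒ g ≠ 1`; `SU(1)` is trivial -/
section SUN

variable {N : ℕ} [NeZero N]

/-- **On `SU(N)` the normalised real trace is `< 1` away from the identity** (`Re Tr g ≤ N` with equality only at `g = 1`: all eigenvalues on the unit circle —
the tree's `QuantumLattice.reTr_le` ∕ `eq_one_of_reTr_eq`). [cite: Balaban1987RG1, (0.2) p.252 («tr 1 = 1»; bookkeeping)] -/
theorem reTr_lt_one_of_ne_one (g : SU N) (hg : g ≠ 1) : reTr g < 1 := by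
  haveI : Nonempty (Fin N) := ⟨⟨0, Nat.pos_of_ne_zero (NeZero.ne N)⟩⟩
  have hlt : Literature.MathematicalPhysics.QuantumLattice.reTr g < Fintype.card (Fin N) :=
    lt_of_le_of_ne (Literature.MathematicalPhysics.QuantumLattice.reTr_le g)
      (fun h => hg (Literature.MathematicalPhysics.QuantumLattice.eq_one_of_reTr_eq g h))
  have hN : (0 : ℝ) < Fintype.card (Fin N) := by exact_mod_cast Fintype.card_pos
  show UnitaryModel.nReTr (fundamentalRep (Fin N) g) < 1
  unfold UnitaryModel.nReTr
  rw [div_lt_one hN]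
  exact hlt

/-- `|g − 1| > 0 ⇒ g ≠ 1` (`|1 − 1| = 0`). [cite: Balaban1985Averaging, (19) p.21 (bookkeeping)] -/
theorem ne_one_of_dist1_pos {G : Type*} [GaugeGroup G] {g : G} (h : 0 < dist1 g) : g ≠ 1 := by
  rintro rfl; rw [GaugeGroup.dist1_one] at h; exact lt_irrefl 0 h

/-- **`SU(1) = {1}`** (a unitary `1 × 1` matrix of determinant `1`). [folklore] -/
theorem eq_one_of_SU_one (g : SU 1) : g = 1 := by
  apply Subtype.ext
  have hdet : (g : Matrix (Fin 1) (Fin 1) ℂ).det = 1 := (Matrix.mem_specialUnitaryGroup_iff.mp g.2).2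
  rw [Matrix.det_fin_one] at hdet
  ext i j
  rw [Subsingleton.elim i 0, Subsingleton.elim j 0, hdet]
  rfl

/-- On `SU(1)` every configuration is the unit configuration, so the Wilson action vanishes identically. [cite: Balaban1987RG1, (0.2) p.252 (bookkeeping)] -/
theorem wilsonAction4_eq_zero_of_SU_one {P : Params} {j : ℕ} (V : GaugeField P j (SU 1)) : wilsonAction4 V = 0 := by
  have hV : V = 1 := funext fun b => eq_one_of_SU_one (V b)
  rw [hV]
  exact B10Eq2DensityTower.wilsonAction4_one

end SUN

/-! ## §3 The exact window: (47)₀ at the record's binders ⟺ `ε₁(0) ≤ εbg ∨ 2 < εbg` -/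
section ExactWindow

variable {N : ℕ} [NeZero N] {L : ℕ}

/-- ★★ **THE EXACT WINDOW ON `SU(N)`, `N ≥ 2`** (`εbg > 0`): «every NON-FLAT configuration of the (4)-window `PlaqSmall (ε₁ 0)` lies in [7]'s level-0 class
`PlaqSmall (εbg·η₀²)`» ⟺ **`ε₁(0) ≤ εbg ∨ 2 < εbg`**.  ⟸: inclusion of the windows (`η₀ = 1`), resp. for `εbg > 2` the class is everything (`|g − 1| ≤ 2`);
⟹: otherwise `0 < εbg < ε₁(0)`, `εbg ≤ 2`, and the one-bond configuration at a `g ∈ SU(N)` with `|g − 1| = εbg` (distance spectrum `[0, 2]`) has all plaquette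
variables within `εbg < ε₁(0)` of `1`, is not flat (`g ≠ 1`), and its plaquette through the bond is EXACTLY at distance `εbg` — not `< εbg`.
[cite: Balaban1985UV3, (4) p.256 + (7) p.257; Balaban1985Variational, (2) p.278; Balaban1985Averaging, (19) p.21] -/
theorem window_iff_consts (hN : 2 ≤ N) (c : Consts L) (hε : 0 < c.εbg) (S : Scales L) :
    (∀ V : GaugeField S.P 0 (SU N), PlaqSmall (eps1OfPrint c S 0) V → 0 < wilsonAction4 V → PlaqSmall (c.εbg * S.eta 0 ^ 2) V) ↔
      (eps1OfPrint c S 0 ≤ c.εbg ∨ 2 < c.εbg) := by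
  constructor
  · intro hwin
    by_contra hnot
    rw [not_or, not_le, not_lt] at hnot
    obtain ⟨hlt, hle2⟩ := hnot
    -- a group element at distance exactly `εbg`
    obtain ⟨g, hg⟩ := Theorems.K0VariationalThm1DatumCoupling.exists_su_dist1_eq (N := N) hN hε.le hle2
    have hne : g ≠ 1 := ne_one_of_dist1_pos (hg.symm ▸ hε)
    obtain ⟨V, hV₀, hV⟩ := exists_oneBond (⟨fun _ => 0, ⟨0, by show 0 < 3; norm_num⟩⟩ : PBond S.P 0) g
    have hwinV : PlaqSmall (eps1OfPrint c S 0) V := plaqSmall_oneBond hV hV₀ (hg.symm ▸ hlt)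
    have hA : 0 < wilsonAction4 V := wilsonAction4_oneBond_pos (zero_lt_one_dir S) hV hV₀ (reTr_lt_one_of_ne_one g hne)
    have hreg := (plaqSmall_eta_zero_iff N S c.εbg V).1 (hwin V hwinV hA)
      ⟨fun _ => 0, ⟨0, by show 0 < 3; norm_num⟩, ⟨1, by show 1 < 3; norm_num⟩, zero_lt_one_dir S⟩
    rw [plaqHol_oneBond_self (zero_lt_one_dir S) hV hV₀, hg] at hreg
    exact lt_irrefl _ hreg
  · rintro (h | h) V hV _
    · exact (plaqSmall_eta_zero_iff N S c.εbg V).2 (plaqSmall_mono h hV)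
    · exact plaqSmall_level_zero_of_two_lt N S h V

variable {𝔞 : ∀ S : Scales L, ∀ j, Averaging S.P j (SU N)} {𝔗 : ∀ S : Scales L, ∀ j, RTOpI S.P j (SU N) (𝔞 S j)}
  {c : Consts L} {S : Scales L} {W : SectB.TowerObjects S (SU N)}

/-- ★★ **(47) AT LEVEL 0 AT THE RECORD'S BINDERS ⟺ `ε₁(0) ≤ εbg ∨ 2 < εbg`** (`SU(N)`, `N ≥ 2`, `εbg > 0`; any tower objects extending
`runObjects₀A N 𝔞 𝔗 (Backgrounds.ofAvg N L 𝔞) c S` with print's k = 0 interaction data (43)@0) — the located side condition of `LevelZero` §2 is EXACTLY this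
condition on the ∃-constants `b₀, p₀, εbg` and the coupling `g₀(S)` (`ε₁(0) = g₀p(g₀)`). [cite: Balaban1985UV3, (47) p.267 + (4) p.256 + (7) p.257; Balaban1985Variational, (2) p.278] -/
theorem ineq47_zero_iff_consts (hN : 2 ≤ N) (hW : W.toRunObjects = runObjects₀A N 𝔞 𝔗 (Backgrounds.ofAvg N L 𝔞) c S)
    (hP0 : ∀ (h : W.Hist 0) (V : GaugeField S.P 0 (SU N)), W.Pint 0 h V = 0) (hε : 0 < c.εbg) :
    B10.Ineq47 W.pin.toTowerRun 0 ↔ (eps1OfPrint c S 0 ≤ c.εbg ∨ 2 < c.εbg) :=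
  (ineq47_zero_iff_window hW hP0).trans (window_iff_consts hN c hε S)

/-- **The refuting regime**: `εbg < ε₁(0)` and `εbg ≤ 2` (`εbg > 0`, `N ≥ 2`) ⇒ (47)₀ FAILS at the record's binders. [cite: Balaban1985UV3, (47) p.267 + (4) p.256 + (7) p.257] -/
theorem not_ineq47_zero_of_consts (hN : 2 ≤ N) (hW : W.toRunObjects = runObjects₀A N 𝔞 𝔗 (Backgrounds.ofAvg N L 𝔞) c S)
    (hP0 : ∀ (h : W.Hist 0) (V : GaugeField S.P 0 (SU N)), W.Pint 0 h V = 0) (hε : 0 < c.εbg)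
    (h1 : c.εbg < eps1OfPrint c S 0) (h2 : c.εbg ≤ 2) : ¬ B10.Ineq47 W.pin.toTowerRun 0 := fun h47 => by
  rcases (ineq47_zero_iff_consts hN hW hP0 hε).1 h47 with h | h
  · exact absurd h (not_le.mpr h1)
  · exact absurd h (not_lt.mpr h2)

/-- ★ **`Step0Printed` ((41)₀ ∧ (47)₀) AT THE RECORD'S BINDERS ⟺ `ε₁(0) ≤ εbg ∨ 2 < εbg`**, given the k = 0 history functional dominating its trivial term
((41)₀ then holds for every configuration, `LevelZero.ineq41_zero`). [cite: Balaban1985UV3, (1) p.256 + (41) p.266 + (47) p.267 + (7) p.257] -/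
theorem step0_iff_consts (hN : 2 ≤ N) (hW : W.toRunObjects = runObjects₀A N 𝔞 𝔗 (Backgrounds.ofAvg N L 𝔞) c S)
    (hP0 : ∀ (h : W.Hist 0) (V : GaugeField S.P 0 (SU N)), W.Pint 0 h V = 0)
    (hLF : ∀ (V : GaugeField S.P 0 (SU N)) (F : W.Hist 0 → ℝ), Real.exp (F (W.triv 0)) ≤ W.LF 0 V F) (hε : 0 < c.εbg) :
    B10.Step0Printed W.pin.toTowerRun ↔ (eps1OfPrint c S 0 ≤ c.εbg ∨ 2 < c.εbg) :=
  ⟨fun h => (ineq47_zero_iff_consts hN hW hP0 hε).1 h.2,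
    fun h => ⟨ineq41_zero hW hP0 hLF, (ineq47_zero_iff_consts hN hW hP0 hε).2 h⟩⟩

/-- **For admissible constants** (`εbg > 0` is a clause of `Consts.Adm`) the same `iff`. [cite: Balaban1985UV3, (47) p.267 + p.256 L15–18 + (7) p.257] -/
theorem ineq47_zero_iff_consts_of_adm (hN : 2 ≤ N) (hW : W.toRunObjects = runObjects₀A N 𝔞 𝔗 (Backgrounds.ofAvg N L 𝔞) c S)
    (hP0 : ∀ (h : W.Hist 0) (V : GaugeField S.P 0 (SU N)), W.Pint 0 h V = 0) (hc : c.Adm) :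
    B10.Ineq47 W.pin.toTowerRun 0 ↔ (eps1OfPrint c S 0 ≤ c.εbg ∨ 2 < c.εbg) :=
  ineq47_zero_iff_consts hN hW hP0 hc.2.2.2

/-- **`N = 1`: (47)₀ HOLDS UNCONDITIONALLY at the record's binders** (every `SU(1)`-valued configuration is the unit one, hence flat; the window condition of
`LevelZero` §2 is vacuous). [cite: Balaban1985UV3, (47) p.267 (degenerate group; bookkeeping)] -/
theorem ineq47_zero_of_N_eq_one {L : ℕ} {𝔞 : ∀ S : Scales L, ∀ j, Averaging S.P j (SU 1)}
    {𝔗 : ∀ S : Scales L, ∀ j, RTOpI S.P j (SU 1) (𝔞 S j)} {c : Consts L} {S : Scales L} {W : SectB.TowerObjects S (SU 1)}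
    (hW : W.toRunObjects = runObjects₀A 1 𝔞 𝔗 (Backgrounds.ofAvg 1 L 𝔞) c S)
    (hP0 : ∀ (h : W.Hist 0) (V : GaugeField S.P 0 (SU 1)), W.Pint 0 h V = 0) : B10.Ineq47 W.pin.toTowerRun 0 :=
  (ineq47_zero_iff_window hW hP0).2 fun V _ hA => absurd (wilsonAction4_eq_zero_of_SU_one V) hA.ne'

/-! ### At the slot of record (`𝔞 := avOfPrint N`, print's own [7]-backgrounds `Backgrounds.ofPrint`, any version `𝔗 : TFamily₃ N L` of (2)) -/

/-- ★★ **(47)₀ AT THE SLOT OF RECORD ⟺ `ε₁(0) ≤ εbg ∨ 2 < εbg`** (`N ≥ 2`, `εbg > 0`, (43)@0). [cite: Balaban1985UV3, (47) p.267 + (4) p.256 + (7) p.257; Balaban1985Variational, (2) p.278] -/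
theorem ineq47_zero_iff_consts_ofPrint (hN : 2 ≤ N) {𝔗 : TFamily₃ N L} {c : Consts L} {S : Scales L} {W : SectB.TowerObjects S (SU N)}
    (hW : W.toRunObjects = runObjects₀T N 𝔗 (Backgrounds.ofPrint N L) c S)
    (hP0 : ∀ (h : W.Hist 0) (V : GaugeField S.P 0 (SU N)), W.Pint 0 h V = 0) (hε : 0 < c.εbg) :
    B10.Ineq47 W.pin.toTowerRun 0 ↔ (eps1OfPrint c S 0 ≤ c.εbg ∨ 2 < c.εbg) :=
  ineq47_zero_iff_consts (𝔞 := avOfPrint N) hN hW hP0 hε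

end ExactWindow

/-! ## §4 The record's Thm-2 conjunct FORCES the condition at every member of the family -/
section Forces

variable {N : ℕ} [NeZero N] {L : ℕ} {𝔞 : ∀ S : Scales L, ∀ j, Averaging S.P j (SU N)}
  {𝔗 : ∀ S : Scales L, ∀ j, RTOpI S.P j (SU N) (𝔞 S j)} {c : Consts L}

/-- ★★ **The ∃-representation reading at level 0 at the record's binders FORCES `ε₁(0) ≤ εbg ∨ 2 < εbg`** (`N ≥ 2`, `εbg > 0`): its tower objects extend the binders,
its leaf system's `noInt0` is (43)@0, and its (47)₀ is §3's. [cite: Balaban1985UV3, Thm 2 p.272 + (47) p.267 + (43) p.266 + (7) p.257] -/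
theorem consts_of_repr41_47G_zero (hN : 2 ≤ N) (hε : 0 < c.εbg) {S : Scales L}
    (h : Repr41_47G N (runObjects₀A N 𝔞 𝔗 (Backgrounds.ofAvg N L 𝔞)) c S 0) : eps1OfPrint c S 0 ≤ c.εbg ∨ 2 < c.εbg := by
  obtain ⟨C, W, hW, ⟨LS⟩, -, h47⟩ := h
  exact (ineq47_zero_iff_consts hN hW (fun h V => LS.noInt0 h V) hε).1 h47

/-- ★★ **THE RECORD'S Thm-2 CONJUNCT `B10.Thm2Printed (runsAtG N (runObjects₀A N 𝔞 𝔗 (Backgrounds.ofAvg N L 𝔞)) c)` FORCES `ε₁(0)(S) ≤ εbg ∨ 2 < εbg` AT EVERY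
MEMBER `S` OF THE FAMILY `Family L c.eps0`** (`N ≥ 2`, `εbg > 0`). [cite: Balaban1985UV3, Thm 2 p.272 + (47) p.267 + (7) p.257 + p.256 L15–18] -/
theorem consts_of_thm2Printed_runsAtG (hN : 2 ≤ N) (hε : 0 < c.εbg)
    (h : B10.Thm2Printed (runsAtG N (runObjects₀A N 𝔞 𝔗 (Backgrounds.ofAvg N L 𝔞)) c)) (S : Family L c.eps0) :
    eps1OfPrint c S.1 0 ≤ c.εbg ∨ 2 < c.εbg :=
  consts_of_repr41_47G_zero hN hε (h S 0 (Nat.zero_le _))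

/-- In the proper regime `εbg ≤ 2` the conjunct pins print's level-0 window below [7]'s radius UNIFORMLY on the family: `ε₁(0)(S) ≤ εbg` for every member.
[cite: Balaban1985UV3, Thm 2 p.272 + (4) p.256 + (7) p.257] -/
theorem eps1_le_of_thm2Printed_runsAtG (hN : 2 ≤ N) (hε : 0 < c.εbg) (hε2 : c.εbg ≤ 2)
    (h : B10.Thm2Printed (runsAtG N (runObjects₀A N 𝔞 𝔗 (Backgrounds.ofAvg N L 𝔞)) c)) (S : Family L c.eps0) :
    eps1OfPrint c S.1 0 ≤ c.εbg :=
  (consts_of_thm2Printed_runsAtG hN hε h S).resolve_right (not_lt.mpr hε2)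

/-- **The refuting regime for the ∃-representation reading**: `0 < εbg ≤ 2` and `εbg < ε₁(0)(S)` ⇒ NO tower objects extending the record's binders at `S` carry a
leaf system with (41)₀ ∧ (47)₀ — `Repr41_47G … c S 0` is FALSE, whatever the `k ≥ 1` leaves. [cite: Balaban1985UV3, Thm 2 p.272 + (47) p.267 + (7) p.257] -/
theorem not_repr41_47G_zero_of_consts (hN : 2 ≤ N) (hε : 0 < c.εbg) (hε2 : c.εbg ≤ 2) {S : Scales L} (hlt : c.εbg < eps1OfPrint c S 0) :
    ¬ Repr41_47G N (runObjects₀A N 𝔞 𝔗 (Backgrounds.ofAvg N L 𝔞)) c S 0 := fun h => by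
  rcases consts_of_repr41_47G_zero hN hε h with h' | h'
  · exact absurd h' (not_le.mpr hlt)
  · exact absurd h' (not_lt.mpr hε2)

/-- **… and for the conjunct**: constants with `0 < εbg ≤ 2` and ONE family member `S` with `εbg < ε₁(0)(S) = g₀(S)p(g₀(S))` do NOT carry the record's Thm-2
conjunct at the binders `runObjects₀A N 𝔞 𝔗 (Backgrounds.ofAvg N L 𝔞)` (the form a supplier of the ∃-constants reads). [cite: Balaban1985UV3, Thm 2 p.272 + (47) p.267 + (7) p.257] -/
theorem not_thm2Printed_runsAtG_of_member (hN : 2 ≤ N) (hε : 0 < c.εbg) (hε2 : c.εbg ≤ 2) (S : Family L c.eps0)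
    (hlt : c.εbg < eps1OfPrint c S.1 0) : ¬ B10.Thm2Printed (runsAtG N (runObjects₀A N 𝔞 𝔗 (Backgrounds.ofAvg N L 𝔞)) c) :=
  fun h => not_repr41_47G_zero_of_consts hN hε hε2 hlt (h S 0 (Nat.zero_le _))

/-- ★★ **EVERY WITNESS OF THE PRINTED PAIR AT THE RECORD'S BINDERS SATISFIES THE CONDITION ON ITS WHOLE FAMILY**: `PrintedUV3G N L (runObjects₀A N 𝔞 𝔗
(Backgrounds.ofAvg N L 𝔞))` (`N ≥ 2`) ⇒ `∃ c`, admissible, carrying Thm 1-compact ∧ Thm 2 there, with «`ε₁(0)(S) ≤ εbg ∨ 2 < εbg`» for every `S ∈ Family L c.eps0`.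
[cite: Balaban1985UV3, Thm 1 p.257 + Thm 2 p.272 + (7) p.257 + p.256 L15–18] -/
theorem consts_of_printedUV3G (hN : 2 ≤ N) (h : PrintedUV3G N L (runObjects₀A N 𝔞 𝔗 (Backgrounds.ofAvg N L 𝔞))) :
    ∃ c : Consts L, c.Adm ∧ b10AtG N (runObjects₀A N 𝔞 𝔗 (Backgrounds.ofAvg N L 𝔞)) c ∧
      ∀ S : Family L c.eps0, eps1OfPrint c S.1 0 ≤ c.εbg ∨ 2 < c.εbg := by
  obtain ⟨c, hc, h12⟩ := h
  exact ⟨c, hc, h12, fun S => consts_of_thm2Printed_runsAtG hN hc.2.2.2 h12.2 S⟩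

/-- **At the slot of record** (`𝔞 := avOfPrint N`, `Backgrounds.ofPrint`, any version `𝔗 : TFamily₃ N L`): every witness `c` of `PrintedUV3G N L (runObjects₀T N 𝔗
(Backgrounds.ofPrint N L))` — the matrix of `Node00.PrintedUV3V N L` — satisfies «`ε₁(0)(S) ≤ εbg ∨ 2 < εbg`» on its whole family (`N ≥ 2`).
[cite: Balaban1985UV3, Thm 1 p.257 + Thm 2 p.272 + (7) p.257] -/
theorem consts_of_printedUV3G_ofPrint (hN : 2 ≤ N) {𝔗 : TFamily₃ N L} (h : PrintedUV3G N L (runObjects₀T N 𝔗 (Backgrounds.ofPrint N L))) :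
    ∃ c : Consts L, c.Adm ∧ b10AtG N (runObjects₀T N 𝔗 (Backgrounds.ofPrint N L)) c ∧
      ∀ S : Family L c.eps0, eps1OfPrint c S.1 0 ≤ c.εbg ∨ 2 < c.εbg :=
  consts_of_printedUV3G (𝔞 := avOfPrint N) hN h

/-- **… hence for the slot of record `Node00.PrintedUV3V N L` itself** (`N ≥ 2`): some admissible `c` carries the printed pair at some version of (2) AND the level-0
condition on its whole family. [cite: Balaban1985UV3, Thm 1 p.257 + Thm 2 p.272 + (7) p.257] -/
theorem consts_of_printedUV3V (hN : 2 ≤ N) (h : Node00.PrintedUV3V N L) :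
    ∃ (𝔗 : TFamily₃ N L) (c : Consts L), c.Adm ∧ b10AtG N (runObjects₀T N 𝔗 (Backgrounds.ofPrint N L)) c ∧
      ∀ S : Family L c.eps0, eps1OfPrint c S.1 0 ≤ c.εbg ∨ 2 < c.εbg := by
  obtain ⟨𝔗, h𝔗⟩ := h
  exact ⟨𝔗, consts_of_printedUV3G_ofPrint hN h𝔗⟩

/-- **… and for the PRIMED slot `Node00.PrintedUV3V' N L`** (chair R451 (R-b): the printed pair along SOME admissible averaging of print's class, [7]-backgrounds read
there; `N ≥ 2`): its witnesses `𝔞, 𝔗, c` satisfy the level-0 condition on the whole family — the condition does not see the averaging. [cite: Balaban1985UV3, Thm 1 p.257 + Thm 2 p.272 + (7) p.257] -/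
theorem consts_of_printedUV3V' (hN : 2 ≤ N) (h : Node00.PrintedUV3V' N L) :
    ∃ (𝔞' : Node00.AvgFamily₃ N L) (𝔗' : Node00.TFamilyA₃ N 𝔞') (c : Consts L), c.Adm ∧ b10AtG N (runObjects₀A N 𝔞' 𝔗' (Backgrounds.ofAvg N L 𝔞')) c ∧
      ∀ S : Family L c.eps0, eps1OfPrint c S.1 0 ≤ c.εbg ∨ 2 < c.εbg := by
  obtain ⟨𝔞', -, 𝔗', h'⟩ := h
  exact ⟨𝔞', 𝔗', consts_of_printedUV3G hN h'⟩

end Forces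

end Summit.QuantumFields.YangMills.BalabanUVNodes.N08Thm2AtRecordWindowExact

end
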